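import Summits.AtomisticToContinuum.BoseEinsteinCondensation.Theorems.BECInfDivCoherenceLevyMassCondensationFourier
import HarnessLib

/-!
# Schur / Schoenberg on the finite torus `(ℤ/m)³` (stub `stub_dftExpPosComb`)

Support lemma for the birth skeleton of the crux
`BECInfDivCoherence.GridInfDivCoherence` (item stmt-AtomisticToContinuum-9114).

On the grid `(ℤ/m)³ = (Fin 3 → Fin m)`, a *non-negative cosine combination*
`f(j) = Σ_q a_q cos(2π q·j/m)`, `a_q ≥ 0`, is a positive-definite function (Bochner form), and so is
`exp ∘ f`: every grid cosine coefficient `Σ_j exp(f(j)) cos(2π p·j/m)` is `≥ 0`.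

Proof (no index arithmetic mod `m`): work with INTEGER frequency vectors `n_s : Fin 3 → ℤ` and
combinations `P(j) = Σ_s c_s cos(2π (Σ_k j_k n_s(k))/m)` with `c_s ≥ 0` over a finite index type.
* products of two such combinations are again of this form
  (`cos α cos β = (cos(α+β) + cos(α−β))/2`, integer frequency vectors add exactly), hence so are
  powers `P^N` (`exists_cosComb_pow`);
* the `p`-th grid coefficient of such a combination is `≥ 0`: by product-to-sum it is
  `Σ_s c_s · ½ (S(n_s + p) + S(n_s − p))` with `S(n) = Σ_j cos(2π j·n/m) ∈ {0, m³}` the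
  roots-of-unity sum `sum_cos_grid` (`sum_cosComb_mul_cos_nonneg`);
* `exp(f(j)) = Σ_N f(j)^N / N!` (`NormedSpace.expSeries_div_hasSum_exp`), the coefficient is a
  finite linear combination of evaluations, and every partial coefficient is `≥ 0`
  (`HasSum.nonneg`).

References: Schoenberg (1938); Berg–Christensen–Ressel, *Harmonic Analysis on Semigroups*
(GTM 100), Ch. 3 Thm 1.12 (Schur) / Cor. 1.14.
-/

noncomputable section

namespace Summit.AtomisticToContinuum.BoseEinsteinCondensation.Theorems

open Finset InfDivGlue

variable {m : ℕ}

/-- Product-to-sum for two integer-frequency grid cosines: the frequency vectors add / subtract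
exactly (no reduction mod `m`). [folklore] -/
theorem cos_grid_mul_cos_grid (j : Fin 3 → Fin m) (n n' : Fin 3 → ℤ) :
    Real.cos (2 * Real.pi * (∑ k, ((j k : ℕ) : ℝ) * (n k : ℝ)) / m) *
        Real.cos (2 * Real.pi * (∑ k, ((j k : ℕ) : ℝ) * (n' k : ℝ)) / m) =
      (Real.cos (2 * Real.pi * (∑ k, ((j k : ℕ) : ℝ) * ((n k + n' k : ℤ) : ℝ)) / m) +
        Real.cos (2 * Real.pi * (∑ k, ((j k : ℕ) : ℝ) * ((n k - n' k : ℤ) : ℝ)) / m)) / 2 := by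
  have h1 : 2 * Real.pi * (∑ k, ((j k : ℕ) : ℝ) * ((n k + n' k : ℤ) : ℝ)) / m =
      2 * Real.pi * (∑ k, ((j k : ℕ) : ℝ) * (n k : ℝ)) / m +
        2 * Real.pi * (∑ k, ((j k : ℕ) : ℝ) * (n' k : ℝ)) / m := by
    simp only [Int.cast_add, mul_add, Finset.sum_add_distrib]
    ring
  have h2 : 2 * Real.pi * (∑ k, ((j k : ℕ) : ℝ) * ((n k - n' k : ℤ) : ℝ)) / m =
      2 * Real.pi * (∑ k, ((j k : ℕ) : ℝ) * (n k : ℝ)) / m -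
        2 * Real.pi * (∑ k, ((j k : ℕ) : ℝ) * (n' k : ℝ)) / m := by
    simp only [Int.cast_sub, mul_sub, Finset.sum_sub_distrib]
    ring
  rw [h1, h2, Real.cos_add, Real.cos_sub]
  ring

/-- Against a grid character, a single integer-frequency grid cosine has a non-negative coefficient:
`Σ_j cos(2π j·n/m) cos(2π p·j/m) = ½ (S(n + p) + S(n − p)) ≥ 0`, where `S(·) ∈ {0, m³}` is the
roots-of-unity sum `sum_cos_grid`. [folklore] -/
theorem sum_cos_grid_mul_cos_nonneg [NeZero m] (n : Fin 3 → ℤ) (p : Fin 3 → Fin m) :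
    0 ≤ ∑ j : Fin 3 → Fin m, Real.cos (2 * Real.pi * (∑ k, ((j k : ℕ) : ℝ) * (n k : ℝ)) / m) *
      Real.cos (2 * Real.pi * (∑ k, ((p k : ℕ) : ℝ) * ((j k : ℕ) : ℝ)) / m) := by
  have hβ : ∀ j : Fin 3 → Fin m,
      Real.cos (2 * Real.pi * (∑ k, ((p k : ℕ) : ℝ) * ((j k : ℕ) : ℝ)) / m) =
        Real.cos (2 * Real.pi * (∑ k, ((j k : ℕ) : ℝ) * ((((p k : ℕ) : ℤ)) : ℝ)) / m) := by
    intro j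
    simp only [Int.cast_natCast, mul_comm]
  have h1 := sum_cos_grid (m := m) (fun k => n k + ((p k : ℕ) : ℤ))
  have h2 := sum_cos_grid (m := m) (fun k => n k - ((p k : ℕ) : ℤ))
  have hS1 : 0 ≤ ∑ j : Fin 3 → Fin m,
      Real.cos (2 * Real.pi * (∑ k, ((j k : ℕ) : ℝ) * ((n k + ((p k : ℕ) : ℤ) : ℤ) : ℝ)) / m) := by
    rw [h1]; split_ifs <;> positivity
  have hS2 : 0 ≤ ∑ j : Fin 3 → Fin m,
      Real.cos (2 * Real.pi * (∑ k, ((j k : ℕ) : ℝ) * ((n k - ((p k : ℕ) : ℤ) : ℤ) : ℝ)) / m) := by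
    rw [h2]; split_ifs <;> positivity
  calc (0 : ℝ) ≤ ((∑ j : Fin 3 → Fin m,
          Real.cos (2 * Real.pi * (∑ k, ((j k : ℕ) : ℝ) * ((n k + ((p k : ℕ) : ℤ) : ℤ) : ℝ)) / m)) +
        ∑ j : Fin 3 → Fin m,
          Real.cos (2 * Real.pi * (∑ k, ((j k : ℕ) : ℝ) * ((n k - ((p k : ℕ) : ℤ) : ℤ) : ℝ)) / m)) /
          2 := by positivity
    _ = _ := by
      rw [← Finset.sum_add_distrib, Finset.sum_div]
      refine Finset.sum_congr rfl fun j _ => ?_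
      rw [hβ j, cos_grid_mul_cos_grid j n (fun k => ((p k : ℕ) : ℤ))]

/-- The `p`-th grid cosine coefficient of a non-negative integer-frequency cosine combination
`Σ_s c_s cos(2π j·n_s/m)`, `c_s ≥ 0`, is non-negative. [folklore] -/
theorem sum_cosComb_mul_cos_nonneg [NeZero m] {ι : Type} [Fintype ι] (n : ι → Fin 3 → ℤ)
    (c : ι → ℝ) (hc : ∀ s, 0 ≤ c s) (p : Fin 3 → Fin m) :
    0 ≤ ∑ j : Fin 3 → Fin m,
      (∑ s, c s * Real.cos (2 * Real.pi * (∑ k, ((j k : ℕ) : ℝ) * (n s k : ℝ)) / m)) *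
        Real.cos (2 * Real.pi * (∑ k, ((p k : ℕ) : ℝ) * ((j k : ℕ) : ℝ)) / m) := by
  calc (0 : ℝ) ≤ ∑ s, ∑ j : Fin 3 → Fin m,
        c s * (Real.cos (2 * Real.pi * (∑ k, ((j k : ℕ) : ℝ) * (n s k : ℝ)) / m) *
          Real.cos (2 * Real.pi * (∑ k, ((p k : ℕ) : ℝ) * ((j k : ℕ) : ℝ)) / m)) := by
        refine Finset.sum_nonneg fun s _ => ?_
        rw [← Finset.mul_sum]
        exact mul_nonneg (hc s) (sum_cos_grid_mul_cos_nonneg (n s) p)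
    _ = _ := by
      rw [Finset.sum_comm]
      refine Finset.sum_congr rfl fun j _ => ?_
      rw [Finset.sum_mul]
      exact Finset.sum_congr rfl fun s _ => (mul_assoc _ _ _).symm

/-- **Powers of non-negative integer-frequency cosine combinations are again such combinations**
(Schur on the finite torus, in Bochner form): by product-to-sum, with the frequency vectors
`n'_s ± n_t` and the coefficients `c'_s c_t / 2 ≥ 0`. [folklore] -/
theorem exists_cosComb_pow {ι : Type} [Fintype ι] (n : ι → Fin 3 → ℤ) (c : ι → ℝ)
    (hc : ∀ s, 0 ≤ c s) (N : ℕ) :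
    ∃ (κ : Type) (_ : Fintype κ) (n' : κ → Fin 3 → ℤ) (c' : κ → ℝ), (∀ s, 0 ≤ c' s) ∧
      ∀ j : Fin 3 → Fin m,
        (∑ s, c s * Real.cos (2 * Real.pi * (∑ k, ((j k : ℕ) : ℝ) * (n s k : ℝ)) / m)) ^ N =
          ∑ s, c' s * Real.cos (2 * Real.pi * (∑ k, ((j k : ℕ) : ℝ) * (n' s k : ℝ)) / m) := by
  induction N with
  | zero =>
    refine ⟨Unit, inferInstance, fun _ _ => 0, fun _ => 1, fun _ => zero_le_one, fun j => ?_⟩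
    simp
  | succ N ih =>
    obtain ⟨κ, _, n', c', hc', hrep⟩ := ih
    refine ⟨(κ × ι) ⊕ (κ × ι), inferInstance,
      Sum.elim (fun x k => n' x.1 k + n x.2 k) (fun x k => n' x.1 k - n x.2 k),
      Sum.elim (fun x => c' x.1 * c x.2 / 2) (fun x => c' x.1 * c x.2 / 2), ?_, fun j => ?_⟩
    · rintro (x | x)
      · exact div_nonneg (mul_nonneg (hc' x.1) (hc x.2)) zero_le_two
      · exact div_nonneg (mul_nonneg (hc' x.1) (hc x.2)) zero_le_two
    · rw [pow_succ, hrep j, Finset.sum_mul_sum, Fintype.sum_sum_type, Fintype.sum_prod_type,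
        Fintype.sum_prod_type, ← Finset.sum_add_distrib]
      refine Finset.sum_congr rfl fun s _ => ?_
      rw [← Finset.sum_add_distrib]
      refine Finset.sum_congr rfl fun t _ => ?_
      simp only [Sum.elim_inl, Sum.elim_inr]
      linear_combination (c' s * c t) * cos_grid_mul_cos_grid j (n' s) (n t)

/-- The `p`-th grid cosine coefficient of every power of a non-negative integer-frequency cosine
combination is non-negative. [folklore] -/
theorem sum_cosComb_pow_mul_cos_nonneg [NeZero m] {ι : Type} [Fintype ι] (n : ι → Fin 3 → ℤ)
    (c : ι → ℝ) (hc : ∀ s, 0 ≤ c s) (p : Fin 3 → Fin m) (N : ℕ) :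
    0 ≤ ∑ j : Fin 3 → Fin m,
      (∑ s, c s * Real.cos (2 * Real.pi * (∑ k, ((j k : ℕ) : ℝ) * (n s k : ℝ)) / m)) ^ N *
        Real.cos (2 * Real.pi * (∑ k, ((p k : ℕ) : ℝ) * ((j k : ℕ) : ℝ)) / m) := by
  obtain ⟨κ, _, n', c', hc', hrep⟩ := exists_cosComb_pow (m := m) n c hc N
  simp_rw [hrep]
  exact sum_cosComb_mul_cos_nonneg n' c' hc' p

/-- **The exponential step**: if every power `F^N` has a non-negative coefficient against the
weights `w`, so does `exp F` — `exp (F j) = Σ_N (F j)^N / N!` and finite sums, products by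
constants and non-strict inequalities pass to `HasSum`. [folklore] -/
theorem sum_exp_mul_nonneg_of_pow {ι : Type} [Fintype ι] (F w : ι → ℝ)
    (h : ∀ N : ℕ, 0 ≤ ∑ j, F j ^ N * w j) : 0 ≤ ∑ j, Real.exp (F j) * w j := by
  have hs : HasSum (fun N : ℕ => ∑ j, F j ^ N / (N.factorial : ℝ) * w j)
      (∑ j, Real.exp (F j) * w j) := by
    refine hasSum_sum fun j _ => HasSum.mul_right _ ?_
    rw [Real.exp_eq_exp_ℝ]
    exact NormedSpace.expSeries_div_hasSum_exp (F j)
  refine hs.nonneg fun N => ?_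
  have e : ∑ j, F j ^ N / (N.factorial : ℝ) * w j = (∑ j, F j ^ N * w j) / N.factorial := by
    rw [Finset.sum_div]
    exact Finset.sum_congr rfl fun j _ => by ring
  rw [e]
  exact div_nonneg (h N) (Nat.cast_nonneg _)

/-- **`stub_dftExpPosComb`** (Schur products on the finite group `(ℤ/m)³`, Schoenberg). If
`f = Σ_q a_q cos(2π q·j/m)` with all `a_q ≥ 0` (a positive-definite grid function in Bochner form),
then every grid Fourier coefficient of `exp ∘ f` is non-negative:
`0 ≤ Σ_j exp(f(j)) cos(2π p·j/m)` for every `p`. Proof: rewrite `f` with integer frequency vectors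
`n_q = q`; powers of non-negative integer-frequency cosine combinations are such combinations
(`exists_cosComb_pow`), whose coefficients are `≥ 0` by the roots-of-unity sum `sum_cos_grid`
(`sum_cosComb_mul_cos_nonneg`); `exp f = Σ_N f^N/N!` passes the sign to the limit
(`sum_exp_mul_nonneg_of_pow`). [Schoenberg1938] -/
theorem stub_dftExpPosComb :
    ∀ (m : ℕ) [NeZero m] (a : (Fin 3 → Fin m) → ℝ), (∀ q, 0 ≤ a q) → ∀ p : Fin 3 → Fin m,
      0 ≤ ∑ j : Fin 3 → Fin m,
        Real.exp (∑ q : Fin 3 → Fin m, a q *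
            Real.cos (2 * Real.pi * (∑ k, ((q k : ℕ) : ℝ) * ((j k : ℕ) : ℝ)) / m)) *
          Real.cos (2 * Real.pi * (∑ k, ((p k : ℕ) : ℝ) * ((j k : ℕ) : ℝ)) / m) := by
  intro m _ a ha p
  -- rewrite the phases of `f` with the integer frequency vectors `n_q k = (q k : ℤ)`
  have hf : ∀ j : Fin 3 → Fin m,
      ∑ q : Fin 3 → Fin m, a q *
          Real.cos (2 * Real.pi * (∑ k, ((q k : ℕ) : ℝ) * ((j k : ℕ) : ℝ)) / m) =
        ∑ q : Fin 3 → Fin m, a q *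
          Real.cos (2 * Real.pi * (∑ k, ((j k : ℕ) : ℝ) * ((((q k : ℕ) : ℤ)) : ℝ)) / m) :=
    fun j => Finset.sum_congr rfl fun q _ => by
      rw [Finset.sum_congr rfl fun k _ => mul_comm ((q k : ℕ) : ℝ) ((j k : ℕ) : ℝ)]
      simp only [Int.cast_natCast]
  simp only [hf]
  refine sum_exp_mul_nonneg_of_pow _ _ fun N => ?_
  exact sum_cosComb_pow_mul_cos_nonneg (m := m)
    (fun (q : Fin 3 → Fin m) (k : Fin 3) => ((q k : ℕ) : ℤ)) a ha p N

end Summit.AtomisticToContinuum.BoseEinsteinCondensation.Theorems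

end
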